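import Literature.NumberTheory.GaloisRepresentations.IdeleClassBarAbsoluteGaloisTransport
import Literature.NumberTheory.GaloisRepresentations.IdeleClassBarModAlphaOneInjective
import Literature.NumberTheory.NumberFields.IdelicArtinMapRestriction
import HarnessLib

/-!
# The four-term sequence of class field theory at a finite level, XI: COHERENCE of the layer transports —
# `absGalEquiv` for two layers `E ≤ E′` agree on `Γ_E^ab`, so an Artin lift of `[y, E′]` is an Artin lift of
# `[N_{E′/E} y, E]`

Cell `bsd-print-cf2` (HOME `run/shared/lean/pub/bsd-print-cf2/`), seat `bsd-line-cf2c-w6` g4, brick §4(d)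
«four-term sequence `0 → Ē_∞ → U_v → 𝒳^{(v)} → A_∞ → 0` (CFT over `𝔎_∞L′`)» of LEAD memo
`Cruxes/SplitBadTwoRankOneOfFacts/RULING-B23-g13.md` §4, crux of record stmt-BirchSwinnertonDyer-24033
`PrintCf2RubinValueTwo.TwoVariableMainConjAtSplitTwoQuad`. Files IX–X (`…FourTermCFTLayerTransport`,
`…FourTermCFTLayerCharacters`) read the level-`F` class field theory of files I–VIII on the subgroup `G_F = Gal(K̄/F) ≤ Γ_K`
through the `F`-linear transport `E.absGalEquiv : G_F ≃* Γ_F` of ONE layer. The (e)-pairing `u(m)(s) = s(rec m)` of the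
(d)-sockets needs Artin lifts `u ∈ G_{F_n}` of the idèles `ι(x_n)` of a norm-coherent sequence to be COHERENT IN `n`
(the sets `A_n(m)` of lifts must be nested), i.e. it needs the transports of two layers `E ≤ E′` to be compatible with
the restriction `Γ_{E′} → Γ_E` and the norm. THIS file:

* `restrictNormalHom_restrictScalars_eq_of_tower` — pure algebra: restriction in a tower `L → L′ → M` of normal
  extensions over `k ⊆ k′`;
* **`restrictNormalHom_absRestrictNormalHom_absGalEquiv`** — for `u ∈ G_{E′} ≤ G_E`, a finite abelian `L/E` (in `\bar E`)
  embedded over `E` into a finite abelian `L′/E′` (in `\bar E′`): `(E′.absGalEquiv u)|_{L′}` restricted to `L` IS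
  `(E.absGalEquiv u)|_L` (both are `u` acting on a copy of `L` inside a Galois layer `M ⊇ E′` of `K̄`: the tree's
  `IdeleClassBar.absRestrictNormalHom_absGalEquiv`, `GalLayer.exists_ge_nonempty_algHom`);
* **`absGaloisRestrictAb_absGaloisAbProj_absGalEquiv`** — on abelianizations the two transports are compatible with the
  restriction `absGaloisRestrictAb E E′ : Γ_{E′}^ab → Γ_E^ab` (along ANY `E`-embedding `\bar E → \bar E′`, here the
  tree's `absClosureEmbedding`): `res^ab ((E′.absGalEquiv u)|_{E′^ab}) = (E.absGalEquiv u)|_{E^ab}` — abelian layers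
  separate `Γ_E^ab` (`eq_of_forall_abRestrict_eq`) and every finite abelian `L/E` sits in a finite abelian `L″/E′`
  (`absoluteGaloisGroup.exists_isAbelianGalois_fixingSubgroup_eq`), exactly as in the tree's
  `absGaloisRestrictAb_ideleArtinMap` (Tate VII 4.3 in the limit);
* **`absGaloisAbProj_absGalEquiv_eq_ideleArtinMap_ideleRelNorm`** — THE NESTING LEMMA: if `u ∈ G_{E′}` is an Artin
  lift at level `E′` of the idèle `y` (`(E′.absGalEquiv u)|_{E′^ab} = [y, E′]`) then `u` is an Artin lift at level `E`
  of `N_{E′/E} y` (`(E.absGalEquiv u)|_{E^ab} = [N_{E′/E} y, E]`); with file VII's `ideleRelNorm_prod_localUnits_eq`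
  (`N ι_{S′}(y′) = ι_S(y)` for norm-compatible semi-local units) the Artin-lift sets of a norm-coherent sequence are nested.

No `sorry`, no definition, no named fact; Theses-free. No summit statement is proved; BSD is not advanced here.

## References
* [CasselsFrohlichANT1967] J. Tate, Ch. VII §4 Prop. 4.3, §5.4–5.6, §11.1. [NeukirchANT1999] Ch. IV §1, Ch. VI (5.2).
* [deShalit1987] Ch. III §1.1–1.3 (`X_∞ = lim← X(F_n)`, norm-coherent units). [Rubin1991] §4 p. 36.
-/

noncomputable section

set_option linter.dupNamespace false -- D-0017: single-problem summit, `…BirchSwinnertonDyer.BirchSwinnertonDyer…` repeats a namespace by design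
set_option autoImplicit false

open Field NumberField
open Literature.NumberTheory Literature.NumberTheory.NumberFields Literature.NumberTheory.GaloisRepresentations
  Literature.NumberTheory.GaloisRepresentations.IdeleClassBar Literature.NumberTheory.AdelicBaseChange

namespace Summit.BirchSwinnertonDyer.BirchSwinnertonDyer.Theorems.PrintCf2.FourTermCFT

/-! ### Restriction in a tower (pure algebra) -/

/-- **Restriction in a tower `L → L′ → M` over `k ⊆ k′`**: if `σ′ = τ′|_{L′}` (`τ′` a `k′`-automorphism of `M`,
`L′/k′` normal) and `σ = τ|_L` (`τ` a `k`-automorphism of `M`, `L/k` normal) with `τ = τ′` pointwise, then `σ′|_L = σ`.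
[cite: NeukirchANT1999, Ch. IV §1] -/
theorem restrictNormalHom_restrictScalars_eq_of_tower {k k' L L' M : Type*} [Field k] [Field k'] [Field L]
    [Field L'] [Field M] [Algebra k k'] [Algebra k L] [Algebra k' L'] [Algebra k L'] [IsScalarTower k k' L']
    [Algebra k M] [Algebra k' M] [IsScalarTower k k' M] [Algebra L L'] [IsScalarTower k L L']
    [Algebra L' M] [IsScalarTower k' L' M] [Algebra L M] [IsScalarTower L L' M] [IsScalarTower k L M]
    [Normal k L] [Normal k' L']
    {σ' : L' ≃ₐ[k'] L'} {τ' : M ≃ₐ[k'] M} (hσ' : σ' = AlgEquiv.restrictNormalHom L' τ')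
    {σ : L ≃ₐ[k] L} {τ : M ≃ₐ[k] M} (hσ : σ = AlgEquiv.restrictNormalHom L τ)
    (hτ : ∀ y, τ y = τ' y) :
    AlgEquiv.restrictNormalHom L (σ'.restrictScalars k) = σ := by
  subst hσ' hσ
  apply AlgEquiv.ext
  intro x
  apply (algebraMap L M).injective
  change algebraMap L M (((AlgEquiv.restrictNormal τ' L').restrictScalars k).restrictNormal L x) =
    algebraMap L M (τ.restrictNormal L x)
  rw [AlgEquiv.restrictNormal_commutes, hτ, IsScalarTower.algebraMap_apply L L' M,
    AlgEquiv.restrictNormal_commutes, AlgEquiv.restrictScalars_apply, AlgEquiv.restrictNormal_commutes,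
    ← IsScalarTower.algebraMap_apply]

/-! ### Coherence of the transports of two layers `E ≤ E′` -/

variable {K : Type} [Field K] [NumberField K]

set_option maxHeartbeats 800000 in
-- instance unification through `IntermediateField`s of two algebraic closures is slow (as for the tree's
-- `IdeleClassBar.absRestrictNormalHom_absGalEquiv`, stated with the same option)
/-- **Per-layer coherence.** For layers `E ≤ E′` of `K̄`, `u ∈ G_{E′}`, a finite abelian `L ⊆ \bar E` over `E` and a
finite abelian `L′ ⊆ \bar E′` over `E′` with an `E`-embedding `ψ₀ : L → L′` (structure maps `E → E′ → L′`):
restricting `(E′.absGalEquiv u)|_{L′}` to `L` gives `(E.absGalEquiv u)|_L`. Both sides are `u` acting on a copy of `L`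
inside a Galois layer `M ⊇ E′` of `K̄` into which `L′` embeds over `E′`. [cite: CasselsFrohlichANT1967, Ch. VII §11.1]
[cite: NeukirchANT1999, Ch. IV §1] -/
theorem restrictNormalHom_absRestrictNormalHom_absGalEquiv {E E' : GalLayer K} (hEE' : E ≤ E')
    (u : (E'.openNormalSubgroup : Subgroup (absoluteGaloisGroup K)))
    (L : IntermediateField E.1 (AlgebraicClosure E.1)) [FiniteDimensional E.1 L] [IsAbelianGalois E.1 L]
    (L' : IntermediateField E'.1 (AlgebraicClosure E'.1)) [FiniteDimensional E'.1 L'] [IsAbelianGalois E'.1 L']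
    (ψ₀ : letI := GalLayer.algebraOfLE hEE'; L →ₐ[E.1] L') :
    letI := GalLayer.algebraOfLE hEE'
    letI : Algebra L L' := ψ₀.toRingHom.toAlgebra
    haveI : IsScalarTower E.1 L L' := IsScalarTower.of_algebraMap_eq fun r => (ψ₀.commutes r).symm
    AlgEquiv.restrictNormalHom L ((absRestrictNormalHom L' (E'.absGalEquiv u)).restrictScalars E.1) =
      absRestrictNormalHom L (E.absGalEquiv ⟨u, GalLayer.coe_openNormalSubgroup_le hEE' u.2⟩) := by
  letI := GalLayer.algebraOfLE hEE'
  letI : Algebra L L' := ψ₀.toRingHom.toAlgebra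
  haveI : IsScalarTower E.1 L L' := IsScalarTower.of_algebraMap_eq fun r => (ψ₀.commutes r).symm
  haveI := E'.finiteDimensional
  -- a Galois layer `M ⊇ E'` of `K̄` into which `L'` embeds over `E'`
  obtain ⟨M, hM, ⟨ψ'⟩⟩ := GalLayer.exists_ge_nonempty_algHom E' L'
  letI := GalLayer.algebraOfLE hM
  letI := GalLayer.algebraOfLE (hEE'.trans hM)
  haveI : IsScalarTower E.1 E'.1 M.1 := GalLayer.isScalarTower_of_le_of_le hEE' hM
  -- algebra structures `L' → M`, `L → M` through `ψ'`, `ψ = ψ' ∘ ψ₀`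
  letI : Algebra L' M.1 := ψ'.toRingHom.toAlgebra
  haveI : IsScalarTower E'.1 L' M.1 := IsScalarTower.of_algebraMap_eq fun r => (ψ'.commutes r).symm
  let ψ : L →ₐ[E.1] M.1 := (ψ'.restrictScalars E.1).comp ψ₀
  -- the two transported restrictions, read on `M` (tree: `absRestrictNormalHom_absGalEquiv`)
  have h1 := absRestrictNormalHom_absGalEquiv hM u L' ψ'
  have h2 := absRestrictNormalHom_absGalEquiv (hEE'.trans hM)
    ⟨u, GalLayer.coe_openNormalSubgroup_le hEE' u.2⟩ L ψ
  letI : Algebra L M.1 := ψ.toRingHom.toAlgebra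
  haveI : IsScalarTower E.1 L M.1 := IsScalarTower.of_algebraMap_eq fun r => (ψ.commutes r).symm
  haveI : IsScalarTower L L' M.1 := IsScalarTower.of_algebraMap_eq fun _ => rfl
  -- both `u|_M`'s act as `u`
  have hτ : ∀ y : M.1,
      ((galTraceQuotEquiv (hEE'.trans hM)).symm
          (QuotientGroup.mk ⟨u, GalLayer.coe_openNormalSubgroup_le hEE' u.2⟩) : M.1 ≃ₐ[E.1] M.1) y =
        ((galTraceQuotEquiv hM).symm (QuotientGroup.mk u) : M.1 ≃ₐ[E'.1] M.1) y := fun y => by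
    apply Subtype.ext
    rw [coe_galTraceQuotEquiv_symm_mk_apply, coe_galTraceQuotEquiv_symm_mk_apply]
  exact restrictNormalHom_restrictScalars_eq_of_tower h1 h2 hτ

/-- **Abelianizations from layers (generic).** For number fields `F ⊆ F′` (abstract, `[Algebra F F′]`), `γ′ ∈ Γ_{F′}`
and `γ ∈ Γ_F`: if for every finite abelian `L/F`, every finite abelian `L′/F′` and every `F`-embedding `ψ₀ : L → L′`
the restriction of `γ′|_{L′}` to `L` is `γ|_L`, then `res^ab (γ′|_{F′^ab}) = γ|_{F^ab}` for the tree's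
`absGaloisRestrictAb F F′` (along `absClosureEmbedding F F′`). The argument of the tree's `absGaloisRestrictAb_ideleArtinMap`
(abelian layers separate `Γ_F^ab`; `ι(L)` lies in a finite abelian `L″/F′`; `absRestrictNormalHom_absGaloisRestrict_eq`)
with `(γ′, γ)` in place of `(g′, [N y, F])`. [cite: CasselsFrohlichANT1967, Ch. VII §4 Prop. 4.3, §5.4–5.6]
[cite: NeukirchANT1999, Ch. IV §1 (1.2)] -/
theorem absGaloisRestrictAb_absGaloisAbProj_eq_of_forall_layer {F F' : Type} [Field F] [NumberField F] [Field F']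
    [NumberField F'] [Algebra F F'] (γ' : absoluteGaloisGroup F') (γ : absoluteGaloisGroup F)
    (h : ∀ (L : IntermediateField F (AlgebraicClosure F)) [FiniteDimensional F L] [IsAbelianGalois F L]
      (L' : IntermediateField F' (AlgebraicClosure F')) [FiniteDimensional F' L'] [IsAbelianGalois F' L']
      (ψ₀ : L →ₐ[F] L'),
      letI : Algebra L L' := ψ₀.toRingHom.toAlgebra
      haveI : IsScalarTower F L L' := IsScalarTower.of_algebraMap_eq fun r => (ψ₀.commutes r).symm
      AlgEquiv.restrictNormalHom L ((absRestrictNormalHom L' γ').restrictScalars F) = absRestrictNormalHom L γ) :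
    absGaloisRestrictAb F F' (absGaloisAbProj F' γ') = absGaloisAbProj F γ := by
  -- adapted from the tree's `NumberFields.absGaloisRestrictAb_ideleArtinMap` (`IdelicArtinMapRestriction` §3)
  refine eq_of_forall_abRestrict_eq fun L _ _ => ?_
  -- the open normal subgroup `res⁻¹(Gal(\bar F/L))` of `Γ_{F'}` and the finite abelian `L''` it cuts out
  set φ : absoluteGaloisGroup F' →* (L ≃ₐ[F] L) :=
    (absRestrictNormalHom L).comp (absGaloisRestrict F F').toMonoidHom with hφ
  haveI : φ.ker.Normal := MonoidHom.normal_ker φ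
  have hUopen : IsOpen (φ.ker : Set (absoluteGaloisGroup F')) := by
    rw [hφ, ← MonoidHom.comap_ker]
    exact (isOpen_ker_absRestrictNormalHom L).preimage (absGaloisRestrict F F').continuous
  have hcomm : ∀ a b : absoluteGaloisGroup F', a * b * a⁻¹ * b⁻¹ ∈ φ.ker := by
    intro a b
    rw [MonoidHom.mem_ker, map_mul, map_mul, map_mul, map_inv, map_inv,
      IsMulCommutative.is_comm.comm (φ a) (φ b), mul_inv_cancel_right, mul_inv_cancel]
  obtain ⟨L'', hfin, habel, hfix⟩ :=
    absoluteGaloisGroup.exists_isAbelianGalois_fixingSubgroup_eq F' φ.ker hUopen hcomm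
  haveI := hfin
  haveI := habel
  -- `ι(L) ⊆ L''`
  have hmem : ∀ x : L, absClosureEmbedding F F' (x : AlgebraicClosure F) ∈ L'' := by
    intro x
    rw [← InfiniteGalois.fixedField_fixingSubgroup L'', IntermediateField.mem_fixedField_iff]
    intro σ hσ
    rw [hfix] at hσ
    have hσ' : absRestrictNormalHom L (absGaloisRestrict F F' σ) = 1 := hσ
    have h1 := congrArg (fun τ : L ≃ₐ[F] L => ((τ x : L) : AlgebraicClosure F)) hσ'
    simp only [AlgEquiv.one_apply] at h1
    rw [show absRestrictNormalHom L (absGaloisRestrict F F' σ) =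
        (absoluteGaloisGroup.toAlgEquiv F (absGaloisRestrict F F' σ)).restrictNormal L from rfl,
      show (((absoluteGaloisGroup.toAlgEquiv F (absGaloisRestrict F F' σ)).restrictNormal L x : L) :
          AlgebraicClosure F) = algebraMap L (AlgebraicClosure F)
          ((absoluteGaloisGroup.toAlgEquiv F (absGaloisRestrict F F' σ)).restrictNormal L x) from rfl,
      AlgEquiv.restrictNormal_commutes, ← absoluteGaloisGroup.smul_def] at h1
    rw [IntermediateField.algebraMap_apply] at h1
    have h2 := absGaloisRestrict_apply_smul F F' σ (x : AlgebraicClosure F)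
    rw [h1, absoluteGaloisGroup.smul_def] at h2
    exact h2.symm
  -- `ψ₀ : L → L''` through `ι`, over `F`
  let ψ₀ : L →ₐ[F] L'' :=
    { toFun := fun x => ⟨absClosureEmbedding F F' (x : AlgebraicClosure F), hmem x⟩
      map_one' := Subtype.ext (by simp)
      map_mul' := fun a b => Subtype.ext (by simp)
      map_zero' := Subtype.ext (by simp)
      map_add' := fun a b => Subtype.ext (by simp)
      commutes' := fun r => Subtype.ext (by
        change absClosureEmbedding F F' ((algebraMap F L r : L) : AlgebraicClosure F) =
          algebraMap F (AlgebraicClosure F') r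
        rw [show ((algebraMap F L r : L) : AlgebraicClosure F) = algebraMap F (AlgebraicClosure F) r
          from rfl, AlgHom.commutes]) }
  letI : Algebra L L'' := ψ₀.toRingHom.toAlgebra
  have hj : ∀ x : L, ((algebraMap L L'' x : L'') : AlgebraicClosure F') =
      absClosureEmbedding F F' (x : AlgebraicClosure F) := fun _ => rfl
  haveI : IsScalarTower F L L'' := IsScalarTower.of_algebraMap_eq fun r => (ψ₀.commutes r).symm
  rw [absGaloisRestrictAb_mk, abRestrict_absGaloisAbProj, abRestrict_absGaloisAbProj,
    absRestrictNormalHom_absGaloisRestrict_eq L L'' hj γ']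
  exact h L L'' ψ₀

set_option maxHeartbeats 800000 in
-- as above: two algebraic closures and their `IntermediateField`s
/-- **Coherence on abelianizations.** For layers `E ≤ E′` and `u ∈ G_{E′}`: the restriction
`res^ab : Γ_{E′}^ab → Γ_E^ab` (the tree's `absGaloisRestrictAb E E′`, along `absClosureEmbedding E E′ : \bar E → \bar E′`)
takes `(E′.absGalEquiv u)|_{E′^ab}` to `(E.absGalEquiv u)|_{E^ab}` (the generic lemma above fed with the per-layer
coherence). [cite: CasselsFrohlichANT1967, Ch. VII §4 Prop. 4.3, §5.4–5.6] [cite: NeukirchANT1999, Ch. IV §1, Ch. VI (5.2)] -/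
theorem absGaloisRestrictAb_absGaloisAbProj_absGalEquiv {E E' : GalLayer K} (hEE' : E ≤ E')
    [NumberField E.1] [NumberField E'.1]
    (u : (E'.openNormalSubgroup : Subgroup (absoluteGaloisGroup K))) :
    letI := GalLayer.algebraOfLE hEE'
    absGaloisRestrictAb E.1 E'.1 (absGaloisAbProj E'.1 (E'.absGalEquiv u)) =
      absGaloisAbProj E.1 (E.absGalEquiv ⟨u, GalLayer.coe_openNormalSubgroup_le hEE' u.2⟩) := by
  letI := GalLayer.algebraOfLE hEE'
  exact absGaloisRestrictAb_absGaloisAbProj_eq_of_forall_layer _ _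
    fun L _ _ L' _ _ ψ₀ => restrictNormalHom_absRestrictNormalHom_absGalEquiv hEE' u L L' ψ₀

/-- **THE NESTING LEMMA: an Artin lift at level `E′` of `y` is an Artin lift at level `E` of `N_{E′/E} y`.** For
layers `E ≤ E′` of `K̄`, `u ∈ G_{E′} = Gal(K̄/E′)` and an idèle `y` of `E′` with `(E′.absGalEquiv u)|_{E′^ab} = [y, E′]`:
`(E.absGalEquiv u)|_{E^ab} = [N_{E′/E} y, E]` (coherence on abelianizations + the tree's
`absGaloisAbProj_absGaloisRestrict_eq_ideleArtinMap_ideleRelNorm`, Tate VII 4.3 / Neukirch VI (5.2)). With file VII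
(`ideleRelNorm_prod_localUnits_eq`: `N_{F_{n′}/F_n} ι_{S_{n′}}(y′) = ι_{S_n}(y)` for `Semilocal.IsNormCompatible`
representatives, ty2 (U2)) the sets of Artin lifts of a norm-coherent sequence of semi-local units are NESTED in `n`, so
their intersection over `n` inside `Γ_K` is non-empty by compactness — the limit Artin element `rec(m) ∈ H′` of the
(e)-pairing. [cite: CasselsFrohlichANT1967, Ch. VII §4 Prop. 4.3] [cite: NeukirchANT1999, Ch. VI (5.2)]
[cite: deShalit1987, Ch. III §1.1–1.3] -/
theorem absGaloisAbProj_absGalEquiv_eq_ideleArtinMap_ideleRelNorm {E E' : GalLayer K} (hEE' : E ≤ E')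
    [NumberField E.1] [NumberField E'.1]
    (u : (E'.openNormalSubgroup : Subgroup (absoluteGaloisGroup K))) (y : ideleGroup E'.1)
    (hu : absGaloisAbProj E'.1 (E'.absGalEquiv u) = ideleArtinMap E'.1 y) :
    letI := GalLayer.algebraOfLE hEE'
    absGaloisAbProj E.1 (E.absGalEquiv ⟨u, GalLayer.coe_openNormalSubgroup_le hEE' u.2⟩) =
      ideleArtinMap E.1 (ideleRelNorm E.1 E'.1 y) := by
  letI := GalLayer.algebraOfLE hEE'
  rw [← absGaloisRestrictAb_absGaloisAbProj_absGalEquiv hEE' u]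
  exact absGaloisAbProj_absGaloisRestrict_eq_ideleArtinMap_ideleRelNorm E.1 E'.1 hu

end Summit.BirchSwinnertonDyer.BirchSwinnertonDyer.Theorems.PrintCf2.FourTermCFT

end
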